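import Summits.ValiantsHypothesis.ValiantsHypothesis.Theorems.LacunarySymmetroidMatrixDescartesCensusDoorA34NullTopEighteenAnatomy

/-!
# `MatrixDescartes` census — DOOR A at `(3,4)`: ANATOMY OF A NULL-NULL SEVENTEEN — what a counterexample to `stub_nullNullCeiling` must look like
# (all `18` surviving slots present, pairwise distinct, every slot coefficient non-zero) and the codimension-one closures this yields

HONEST FRAMING.  Object-search cell `pub-symmetroid`, engine seat `val-sym-eng-2` (g4); helper rows beside the registered strata line
`Cruxes/DoorA34/Lines/strata.lean` on stmt-ValiantsHypothesis-19980 (`DoorA34 = PosRootLawAt 3 4 18`: OPEN, typed, never asserted here).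
Stub `stub_nullNullCeiling`: symmetric letters, `StrictMono d`, `det S₀ = det S₃ = 0` ⇒ `≤ 16` positive roots (Descartes ceiling of the stratum
`17`, kernel `Census.posRoots_le_17_of_singular_ends`).  Companion of `…NullTopEighteenAnatomy` (the null-top sheet): here BOTH end cubes are dead
and a counterexample is a SEVENTEEN on the `18` remaining slots.  For ANY real letters (symmetry never used):

* `support_det_pencil_subset_of_nullNull` — with `det S₀ = det S₃ = 0` the support of `det F` lies in the image of the `18` multisets
  `s ∉ { {0,0,0}, {3,3,3} }` (ANY `d`, including degenerate ones); `card_support_le_18_of_nullNull` (cf. `Census.card_support_le_18_of_two_singular_letters`,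
  which needs the two end cubes uniquely represented — not needed here);
* `support_det_pencil_eq_of_nullNull_seventeen`, `sym_sum_injOn_of_nullNull_seventeen`, `coeff_sym_sum_ne_zero_of_nullNull_seventeen` — with `17`
  positive roots the support IS that image: the `18` slot exponents are pairwise distinct and every slot coefficient is non-zero;
* sorted support (`StrictMono d`): `sym_eq_of_sum_eq_of_nullNull_seventeen` (slots uncollided), `det_letter_ne_zero_of_nullNull_seventeen`
  (`det S₁, det S₂ ≠ 0`), `trace_adjugate_mul_ne_zero_of_nullNull_seventeen` (`tr(adj S_i·S_k) ≠ 0`, ALL `i ≠ k`: bottom window `i = 0`, top window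
  `i = 3`, and the rest), `mixed_ne_zero_of_nullNull_seventeen`;
* CLOSURES (each: `StrictMono d`, `det S₀ = det S₃ = 0`, one more vanishing ⇒ `≤ 16`, i.e. `stub_nullNullCeiling` HOLDS there):
  `posRoots_le_16_of_nullNull_of_det_eq_zero` (a singular MIDDLE letter), `posRoots_le_16_of_nullNull_of_trace_adjugate_mul_eq_zero` (`12` walls; the
  two of record are p575885's `tr(adj S₃·S₂) = 0` and p576969's bottom mirror `tr(adj S₀·S₁) = 0`), `posRoots_le_16_of_nullNull_of_mixed_eq_zero`
  (`4` walls); packaged as `nullNullCeiling_of_slot_eq_zero`.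

So the OPEN content of `stub_nullNullCeiling` is exactly the FULL null-null sheet (`18` distinct slot exponents, `18` non-zero slot coefficients).
Nothing here bounds anything there; `DoorA34` and the three stubs stay OPEN; registers unchanged; nothing on `MatrixDescartes`
(stmt-ValiantsHypothesis-18050) or `VP ≠ VNP` — VP≠VNP not moved.  [folklore] Sparse Descartes rule + multilinearity of the determinant; elementary.
-/

-- `Summit.ValiantsHypothesis.ValiantsHypothesis.…` repeats a component by the D-0017 layout
-- (single-conjunct summit), which the `dupNamespace` linter flags; the name is mandated.
set_option linter.dupNamespace false

namespace Summit.ValiantsHypothesis.ValiantsHypothesis.Theorems.LacunarySymmetroidMatrixDescartes.Census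

open Polynomial Finset
open scoped BigOperators Polynomial Matrix

/-- **Support on the null-null stratum (any `d`, any real letters).**  If `det S₀ = det S₃ = 0`, every monomial of `det (∑ l, X^(d l) • S l)` is
the sum of a multiset `s ∉ { {0,0,0}, {3,3,3} }`. [folklore] -/
theorem support_det_pencil_subset_of_nullNull (d : Fin 4 → ℕ) (S : Fin 4 → Matrix (Fin 3) (Fin 3) ℝ) (h0 : (S 0).det = 0)
    (h3 : (S 3).det = 0) :
    (Matrix.det (∑ l, ((X : ℝ[X]) ^ d l) • (S l).map C)).support
      ⊆ (((Finset.univ : Finset (Sym (Fin 4) 3)).erase (Sym.replicate 3 3)).erase (Sym.replicate 3 0)).image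
          (fun s : Sym (Fin 4) 3 => ((s : Multiset (Fin 4)).map d).sum) := by
  intro n hn
  by_contra hnot
  have hne : (Matrix.det (∑ l, ((X : ℝ[X]) ^ d l) • (S l).map C)).coeff n ≠ 0 := mem_support_iff.mp hn
  -- every row-to-letter map with exponent `n` is constant `0` or constant `3`
  have hconst : ∀ f : Fin 3 → Fin 4, (∑ i, d (f i)) = n → (∀ i, f i = 0) ∨ (∀ i, f i = 3) := by
    intro f hf
    set sf : Sym (Fin 4) 3 := ⟨Finset.univ.val.map f, StubDescartesCeiling.card_map_univ_val f⟩ with hsf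
    by_cases hs3 : sf = Sym.replicate 3 3
    · exact Or.inr fun i => fun_const_of_sym_eq_replicate f 3 hs3 i
    by_cases hs0 : sf = Sym.replicate 3 0
    · exact Or.inl fun i => fun_const_of_sym_eq_replicate f 0 hs0 i
    exfalso
    refine hnot (Finset.mem_image.mpr ⟨sf, Finset.mem_erase.mpr ⟨hs0, Finset.mem_erase.mpr ⟨hs3, Finset.mem_univ _⟩⟩, ?_⟩)
    rw [← hf]
    exact sym_sum_of_fun d f
  -- in fact they are all constant with the SAME value `l ∈ {0, 3}`
  have hone : ∃ l : Fin 4, (S l).det = 0 ∧ ∀ f : Fin 3 → Fin 4, (∑ i, d (f i)) = n → ∀ i, f i = l := by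
    by_cases hall0 : ∀ f : Fin 3 → Fin 4, (∑ i, d (f i)) = n → ∀ i, f i = 0
    · exact ⟨0, h0, hall0⟩
    by_cases hall3 : ∀ f : Fin 3 → Fin 4, (∑ i, d (f i)) = n → ∀ i, f i = 3
    · exact ⟨3, h3, hall3⟩
    exfalso
    -- a map that is not constant `0` is constant `3` and vice versa, so `n = 3·d 0 = 3·d 3`
    have h03 : n = 3 * d 3 ∧ n = 3 * d 0 := by
      constructor
      · by_contra hn3
        refine hall0 fun f hf i => ?_
        rcases hconst f hf with hc | hc
        · exact hc i
        · exfalso; apply hn3; rw [← hf]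
          simp only [hc, Finset.sum_const, Finset.card_univ, Fintype.card_fin, smul_eq_mul]
      · by_contra hn0
        refine hall3 fun f hf i => ?_
        rcases hconst f hf with hc | hc
        · exfalso; apply hn0; rw [← hf]
          simp only [hc, Finset.sum_const, Finset.card_univ, Fintype.card_fin, smul_eq_mul]
        · exact hc i
    -- then `![0,0,3]` realises `n` with a multiset outside the two cubes
    have hg : (∑ i, d ((![0, 0, 3] : Fin 3 → Fin 4) i)) = n := by
      simp only [Fin.sum_univ_three, Matrix.cons_val_zero, Matrix.cons_val_one, Matrix.head_cons, Matrix.cons_val_two,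
        Matrix.tail_cons]
      omega
    rcases hconst _ hg with hc | hc
    · exact absurd (hc 2) (by decide)
    · exact absurd (hc 0) (by decide)
  obtain ⟨l, hl, huniq⟩ := hone
  have hn : n = 3 * d l := by
    by_contra hnl
    refine hne (StubDescartesCeiling.coeff_det_pencil_eq_zero d S fun f hf => ?_)
    apply hnl
    rw [← hf]
    simp only [huniq f hf, Finset.sum_const, Finset.card_univ, Fintype.card_fin, smul_eq_mul]
  subst hn
  rw [coeff_det_pencil_three_mul d S l huniq, hl] at hne
  exact hne rfl

/-- On the null-null stratum the determinant has at most `18` monomials (any `d`, any letters). [folklore] -/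
theorem card_support_le_18_of_nullNull (d : Fin 4 → ℕ) (S : Fin 4 → Matrix (Fin 3) (Fin 3) ℝ) (h0 : (S 0).det = 0)
    (h3 : (S 3).det = 0) : (Matrix.det (∑ l, ((X : ℝ[X]) ^ d l) • (S l).map C)).support.card ≤ 18 := by
  refine (Finset.card_le_card (support_det_pencil_subset_of_nullNull d S h0 h3)).trans (Finset.card_image_le.trans ?_)
  rw [Finset.card_erase_of_mem, Finset.card_erase_of_mem (Finset.mem_univ _), Finset.card_univ, Sym.card_sym_eq_choose]
  · decide
  · exact Finset.mem_erase.mpr ⟨fun h => absurd ((Sym.replicate_right_inj (by norm_num)).1 h) (by decide), Finset.mem_univ _⟩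

/-- **`17` roots on the null-null sheet force all `18` slots.** [folklore] -/
theorem support_det_pencil_eq_of_nullNull_seventeen (d : Fin 4 → ℕ) (S : Fin 4 → Matrix (Fin 3) (Fin 3) ℝ) (h0 : (S 0).det = 0)
    (h3 : (S 3).det = 0)
    (h17 : 17 ≤ ((Matrix.det (∑ l, ((X : ℝ[X]) ^ d l) • (S l).map C)).roots.toFinset.filter (fun t => 0 < t)).card) :
    (Matrix.det (∑ l, ((X : ℝ[X]) ^ d l) • (S l).map C)).support
      = (((Finset.univ : Finset (Sym (Fin 4) 3)).erase (Sym.replicate 3 3)).erase (Sym.replicate 3 0)).image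
          (fun s : Sym (Fin 4) 3 => ((s : Multiset (Fin 4)).map d).sum) := by
  have hP : Matrix.det (∑ l, ((X : ℝ[X]) ^ d l) • (S l).map C) ≠ 0 := by
    intro h
    rw [h, Polynomial.roots_zero, Multiset.toFinset_zero, Finset.filter_empty, Finset.card_empty] at h17
    omega
  have hlt := Literature.Computability.AlgebraicComplexity.card_roots_toFinset_filter_pos_lt_card_support hP
  have hsub := support_det_pencil_subset_of_nullNull d S h0 h3
  have h18 := card_support_le_18_of_nullNull d S h0 h3
  have hcard : ((((Finset.univ : Finset (Sym (Fin 4) 3)).erase (Sym.replicate 3 3)).erase (Sym.replicate 3 0)).image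
      (fun s : Sym (Fin 4) 3 => ((s : Multiset (Fin 4)).map d).sum)).card ≤ 18 := by
    refine Finset.card_image_le.trans ?_
    rw [Finset.card_erase_of_mem, Finset.card_erase_of_mem (Finset.mem_univ _), Finset.card_univ, Sym.card_sym_eq_choose]
    · decide
    · exact Finset.mem_erase.mpr ⟨fun h => absurd ((Sym.replicate_right_inj (by norm_num)).1 h) (by decide), Finset.mem_univ _⟩
  exact Finset.eq_of_subset_of_card_le hsub (by omega)

/-- With `17` roots on the null-null sheet the `18` slot exponents are PAIRWISE DISTINCT. [folklore] -/
theorem sym_sum_injOn_of_nullNull_seventeen (d : Fin 4 → ℕ) (S : Fin 4 → Matrix (Fin 3) (Fin 3) ℝ) (h0 : (S 0).det = 0)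
    (h3 : (S 3).det = 0)
    (h17 : 17 ≤ ((Matrix.det (∑ l, ((X : ℝ[X]) ^ d l) • (S l).map C)).roots.toFinset.filter (fun t => 0 < t)).card) :
    Set.InjOn (fun s : Sym (Fin 4) 3 => ((s : Multiset (Fin 4)).map d).sum)
      ↑(((Finset.univ : Finset (Sym (Fin 4) 3)).erase (Sym.replicate 3 3)).erase (Sym.replicate 3 0)) := by
  have hP : Matrix.det (∑ l, ((X : ℝ[X]) ^ d l) • (S l).map C) ≠ 0 := by
    intro h
    rw [h, Polynomial.roots_zero, Multiset.toFinset_zero, Finset.filter_empty, Finset.card_empty] at h17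
    omega
  have hlt := Literature.Computability.AlgebraicComplexity.card_roots_toFinset_filter_pos_lt_card_support hP
  have heq := support_det_pencil_eq_of_nullNull_seventeen d S h0 h3 h17
  have h18 : (((Finset.univ : Finset (Sym (Fin 4) 3)).erase (Sym.replicate 3 3)).erase (Sym.replicate 3 0)).card = 18 := by
    rw [Finset.card_erase_of_mem, Finset.card_erase_of_mem (Finset.mem_univ _), Finset.card_univ, Sym.card_sym_eq_choose]
    · decide
    · exact Finset.mem_erase.mpr ⟨fun h => absurd ((Sym.replicate_right_inj (by norm_num)).1 h) (by decide), Finset.mem_univ _⟩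
  rw [← Finset.card_image_iff]
  refine le_antisymm Finset.card_image_le ?_
  rw [← heq, h18]
  omega

/-- With `17` roots on the null-null sheet EVERY slot coefficient is non-zero. [folklore] -/
theorem coeff_sym_sum_ne_zero_of_nullNull_seventeen (d : Fin 4 → ℕ) (S : Fin 4 → Matrix (Fin 3) (Fin 3) ℝ) (h0 : (S 0).det = 0)
    (h3 : (S 3).det = 0)
    (h17 : 17 ≤ ((Matrix.det (∑ l, ((X : ℝ[X]) ^ d l) • (S l).map C)).roots.toFinset.filter (fun t => 0 < t)).card)
    (s : Sym (Fin 4) 3) (hs3 : s ≠ Sym.replicate 3 3) (hs0 : s ≠ Sym.replicate 3 0) :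
    (Matrix.det (∑ l, ((X : ℝ[X]) ^ d l) • (S l).map C)).coeff (((s : Multiset (Fin 4)).map d).sum) ≠ 0 := by
  rw [← mem_support_iff, support_det_pencil_eq_of_nullNull_seventeen d S h0 h3 h17]
  exact Finset.mem_image.mpr ⟨s, Finset.mem_erase.mpr ⟨hs0, Finset.mem_erase.mpr ⟨hs3, Finset.mem_univ _⟩⟩, rfl⟩

/-- For a sorted support every multiset `s ≠ {0,0,0}` has exponent `> 3·d 0`. [folklore] -/
theorem bottom_lt_sym_sum_of_strictMono (d : Fin 4 → ℕ) (hd : StrictMono d) (s : Sym (Fin 4) 3) (hs : s ≠ Sym.replicate 3 0) :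
    3 * d 0 < ((s : Multiset (Fin 4)).map d).sum := by
  have hle : ∀ l : Fin 4, d 0 ≤ d l := fun l => hd.monotone (Fin.zero_le l)
  obtain ⟨a, ha, ha0⟩ : ∃ a ∈ (s : Multiset (Fin 4)), a ≠ 0 := by
    by_contra hall
    exact hs (Sym.eq_replicate_iff.2 fun b hb => by
      by_contra hb0
      exact hall ⟨b, hb, hb0⟩)
  obtain ⟨t, ht⟩ := Multiset.exists_cons_of_mem ha
  have hcard : Multiset.card t = 2 := by
    have hcs : Multiset.card (s : Multiset (Fin 4)) = 3 := Sym.card_coe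
    rw [ht, Multiset.card_cons] at hcs
    omega
  have hlt : d 0 < d a := hd (lt_of_le_of_ne (Fin.zero_le a) (Ne.symm ha0))
  have hsum_t : 2 * d 0 ≤ (t.map d).sum := by
    have h := Multiset.card_nsmul_le_sum (s := t.map d) (a := d 0) (by
      intro x hx
      obtain ⟨l, -, rfl⟩ := Multiset.mem_map.mp hx
      exact hle l)
    simpa [hcard] using h
  rw [ht, Multiset.map_cons, Multiset.sum_cons]
  omega

/-- **Uncollided slots** on the null-null sheet (sorted support, `17` roots): a row-to-letter map realising the exponent of a slot
`s ∉ { {0,0,0}, {3,3,3} }` has value multiset exactly `s`. [folklore] -/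
theorem sym_eq_of_sum_eq_of_nullNull_seventeen (d : Fin 4 → ℕ) (hd : StrictMono d) (S : Fin 4 → Matrix (Fin 3) (Fin 3) ℝ)
    (h0 : (S 0).det = 0) (h3 : (S 3).det = 0)
    (h17 : 17 ≤ ((Matrix.det (∑ l, ((X : ℝ[X]) ^ d l) • (S l).map C)).roots.toFinset.filter (fun t => 0 < t)).card)
    (s : Sym (Fin 4) 3) (hs3 : s ≠ Sym.replicate 3 3) (hs0 : s ≠ Sym.replicate 3 0) (f : Fin 3 → Fin 4)
    (hf : (∑ i, d (f i)) = ((s : Multiset (Fin 4)).map d).sum) :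
    (⟨Finset.univ.val.map f, StubDescartesCeiling.card_map_univ_val f⟩ : Sym (Fin 4) 3) = s := by
  set sf : Sym (Fin 4) 3 := ⟨Finset.univ.val.map f, StubDescartesCeiling.card_map_univ_val f⟩ with hsf
  have hsum : ((sf : Multiset (Fin 4)).map d).sum = ((s : Multiset (Fin 4)).map d).sum := by
    rw [← hf]; exact sym_sum_of_fun d f
  have hsf3 : sf ≠ Sym.replicate 3 3 := by
    intro h
    have hlt := sym_sum_lt_top_of_strictMono d hd s hs3
    have hc : ∀ i, f i = 3 := fun i => fun_const_of_sym_eq_replicate f 3 h i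
    have : (∑ i, d (f i)) = 3 * d 3 := by
      simp only [hc, Finset.sum_const, Finset.card_univ, Fintype.card_fin, smul_eq_mul]
    omega
  have hsf0 : sf ≠ Sym.replicate 3 0 := by
    intro h
    have hlt := bottom_lt_sym_sum_of_strictMono d hd s hs0
    have hc : ∀ i, f i = 0 := fun i => fun_const_of_sym_eq_replicate f 0 h i
    have : (∑ i, d (f i)) = 3 * d 0 := by
      simp only [hc, Finset.sum_const, Finset.card_univ, Fintype.card_fin, smul_eq_mul]
    omega
  exact sym_sum_injOn_of_nullNull_seventeen d S h0 h3 h17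
    (Finset.mem_coe.2 (Finset.mem_erase.mpr ⟨hsf0, Finset.mem_erase.mpr ⟨hsf3, Finset.mem_univ _⟩⟩))
    (Finset.mem_coe.2 (Finset.mem_erase.mpr ⟨hs0, Finset.mem_erase.mpr ⟨hs3, Finset.mem_univ _⟩⟩)) hsum

/-- **CUBES.**  Sorted support, `det S₀ = det S₃ = 0` and `17` roots ⇒ the two MIDDLE letters are non-singular. [folklore] -/
theorem det_letter_ne_zero_of_nullNull_seventeen (d : Fin 4 → ℕ) (hd : StrictMono d) (S : Fin 4 → Matrix (Fin 3) (Fin 3) ℝ)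
    (h0 : (S 0).det = 0) (h3 : (S 3).det = 0)
    (h17 : 17 ≤ ((Matrix.det (∑ l, ((X : ℝ[X]) ^ d l) • (S l).map C)).roots.toFinset.filter (fun t => 0 < t)).card)
    (l : Fin 4) (hl0 : l ≠ 0) (hl3 : l ≠ 3) : (S l).det ≠ 0 := by
  have hs3 : Sym.replicate 3 l ≠ Sym.replicate 3 (3 : Fin 4) := fun h => hl3 ((Sym.replicate_right_inj (by norm_num)).1 h)
  have hs0 : Sym.replicate 3 l ≠ Sym.replicate 3 (0 : Fin 4) := fun h => hl0 ((Sym.replicate_right_inj (by norm_num)).1 h)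
  have key := coeff_sym_sum_ne_zero_of_nullNull_seventeen d S h0 h3 h17 _ hs3 hs0
  have hσ : (((Sym.replicate 3 l : Sym (Fin 4) 3) : Multiset (Fin 4)).map d).sum = 3 * d l := by
    simp only [Sym.coe_replicate, Multiset.map_replicate, Multiset.sum_replicate, smul_eq_mul]
  have huniq : ∀ f : Fin 3 → Fin 4, (∑ i, d (f i)) = 3 * d l → ∀ i, f i = l := by
    intro f hf i
    exact fun_const_of_sym_eq_replicate f l (sym_eq_of_sum_eq_of_nullNull_seventeen d hd S h0 h3 h17 _ hs3 hs0 f (hf.trans hσ.symm)) i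
  rwa [hσ, coeff_det_pencil_three_mul d S l huniq] at key

/-- **SQUARES.**  Sorted support, `det S₀ = det S₃ = 0` and `17` roots ⇒ `tr(adj S_i · S_k) ≠ 0` for ALL `i ≠ k` (bottom window `i = 0`,
top window `i = 3`, middle and core squares). [folklore] -/
theorem trace_adjugate_mul_ne_zero_of_nullNull_seventeen (d : Fin 4 → ℕ) (hd : StrictMono d) (S : Fin 4 → Matrix (Fin 3) (Fin 3) ℝ)
    (h0 : (S 0).det = 0) (h3 : (S 3).det = 0)
    (h17 : 17 ≤ ((Matrix.det (∑ l, ((X : ℝ[X]) ^ d l) • (S l).map C)).roots.toFinset.filter (fun t => 0 < t)).card)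
    (i k : Fin 4) (hik : i ≠ k) : ((S i).adjugate * S k).trace ≠ 0 := by
  set s : Sym (Fin 4) 3 := ⟨{i, i, k}, by simp⟩ with hsdef
  have hne : ∀ c : Fin 4, s ≠ Sym.replicate 3 c := by
    intro c h
    have hmem : k ∈ (s : Multiset (Fin 4)) := by simp [hsdef]
    have hmem' : i ∈ (s : Multiset (Fin 4)) := by simp [hsdef]
    rw [h] at hmem hmem'
    rw [Sym.coe_replicate] at hmem hmem'
    exact hik ((Multiset.eq_of_mem_replicate hmem').trans (Multiset.eq_of_mem_replicate hmem).symm)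
  have key := coeff_sym_sum_ne_zero_of_nullNull_seventeen d S h0 h3 h17 s (hne 3) (hne 0)
  have hσ : ((s : Multiset (Fin 4)).map d).sum = 2 * d i + d k := by
    simp only [hsdef, Sym.coe_mk, Multiset.insert_eq_cons, Multiset.map_cons, Multiset.sum_cons, Multiset.map_singleton,
      Multiset.sum_singleton]
    ring
  have huniq : ∀ f : Fin 3 → Fin 4, (∑ t, d (f t)) = 2 * d i + d k → f = ![i, i, k] ∨ f = ![i, k, i] ∨ f = ![k, i, i] := by
    intro f hf
    have h := sym_eq_of_sum_eq_of_nullNull_seventeen d hd S h0 h3 h17 s (hne 3) (hne 0) f (hf.trans hσ.symm)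
    have hval : (Finset.univ.val.map f : Multiset (Fin 4)) = {i, i, k} := by
      have := congrArg (fun u : Sym (Fin 4) 3 => (u : Multiset (Fin 4))) h
      simpa [hsdef] using this
    exact fun_eq_of_map_univ_eq_pair i k hik f hval
  rwa [hσ, coeff_det_pencil_three_square d S hik huniq] at key

/-- **MIXED.**  Sorted support, `det S₀ = det S₃ = 0` and `17` roots ⇒ the four fully polarised coefficients are non-zero. [folklore] -/
theorem mixed_ne_zero_of_nullNull_seventeen (d : Fin 4 → ℕ) (hd : StrictMono d) (S : Fin 4 → Matrix (Fin 3) (Fin 3) ℝ)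
    (h0 : (S 0).det = 0) (h3 : (S 3).det = 0)
    (h17 : 17 ≤ ((Matrix.det (∑ l, ((X : ℝ[X]) ^ d l) • (S l).map C)).roots.toFinset.filter (fun t => 0 < t)).card)
    (i j k : Fin 4) (hij : i ≠ j) (hik : i ≠ k) (hjk : j ≠ k) :
    (((S i + S j).adjugate - (S i).adjugate - (S j).adjugate) * S k).trace ≠ 0 := by
  set s : Sym (Fin 4) 3 := ⟨{i, j, k}, by simp⟩ with hsdef
  have hne : ∀ c : Fin 4, s ≠ Sym.replicate 3 c := by
    intro c h
    have hmem : i ∈ (s : Multiset (Fin 4)) := by simp [hsdef]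
    have hmem' : j ∈ (s : Multiset (Fin 4)) := by simp [hsdef]
    rw [h] at hmem hmem'
    rw [Sym.coe_replicate] at hmem hmem'
    exact hij ((Multiset.eq_of_mem_replicate hmem).trans (Multiset.eq_of_mem_replicate hmem').symm)
  have key := coeff_sym_sum_ne_zero_of_nullNull_seventeen d S h0 h3 h17 s (hne 3) (hne 0)
  have hσ : ((s : Multiset (Fin 4)).map d).sum = d i + d j + d k := by
    simp only [hsdef, Sym.coe_mk, Multiset.insert_eq_cons, Multiset.map_cons, Multiset.sum_cons, Multiset.map_singleton,
      Multiset.sum_singleton]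
    ring
  have huniq : ∀ f : Fin 3 → Fin 4, (∑ t, d (f t)) = d i + d j + d k →
      f = ![i, j, k] ∨ f = ![i, k, j] ∨ f = ![j, i, k] ∨ f = ![j, k, i] ∨ f = ![k, i, j] ∨ f = ![k, j, i] := by
    intro f hf
    have h := sym_eq_of_sum_eq_of_nullNull_seventeen d hd S h0 h3 h17 s (hne 3) (hne 0) f (hf.trans hσ.symm)
    have hval : (Finset.univ.val.map f : Multiset (Fin 4)) = {i, j, k} := by
      have := congrArg (fun u : Sym (Fin 4) 3 => (u : Multiset (Fin 4))) h
      simpa [hsdef] using this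
    exact fun_eq_of_map_univ_eq_triple i j k hij hik hjk f hval
  rwa [hσ, coeff_det_pencil_three_mixed d S hij hik hjk huniq] at key

/-- **CLOSURE 1 — a singular MIDDLE letter.**  Sorted support, `det S₀ = det S₃ = 0` and `det S_l = 0` for a middle letter ⇒ `≤ 16`. [folklore] -/
theorem posRoots_le_16_of_nullNull_of_det_eq_zero (d : Fin 4 → ℕ) (hd : StrictMono d) (S : Fin 4 → Matrix (Fin 3) (Fin 3) ℝ)
    (h0 : (S 0).det = 0) (h3 : (S 3).det = 0) (l : Fin 4) (hl0 : l ≠ 0) (hl3 : l ≠ 3) (hdet : (S l).det = 0) :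
    ((Matrix.det (∑ k, ((X : ℝ[X]) ^ d k) • (S k).map C)).roots.toFinset.filter (fun t => 0 < t)).card ≤ 16 := by
  by_contra h
  exact det_letter_ne_zero_of_nullNull_seventeen d hd S h0 h3 (by omega) l hl0 hl3 hdet

/-- **CLOSURE 2 — a vanishing square coefficient** (`12` walls; `i = 3, k = 2` is p575885's, `i = 0, k = 1` is p576969's mirror). [folklore] -/
theorem posRoots_le_16_of_nullNull_of_trace_adjugate_mul_eq_zero (d : Fin 4 → ℕ) (hd : StrictMono d)
    (S : Fin 4 → Matrix (Fin 3) (Fin 3) ℝ) (h0 : (S 0).det = 0) (h3 : (S 3).det = 0) (i k : Fin 4) (hik : i ≠ k)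
    (htr : ((S i).adjugate * S k).trace = 0) :
    ((Matrix.det (∑ l, ((X : ℝ[X]) ^ d l) • (S l).map C)).roots.toFinset.filter (fun t => 0 < t)).card ≤ 16 := by
  by_contra h
  exact trace_adjugate_mul_ne_zero_of_nullNull_seventeen d hd S h0 h3 (by omega) i k hik htr

/-- **CLOSURE 3 — a vanishing mixed coefficient** (`4` walls). [folklore] -/
theorem posRoots_le_16_of_nullNull_of_mixed_eq_zero (d : Fin 4 → ℕ) (hd : StrictMono d)
    (S : Fin 4 → Matrix (Fin 3) (Fin 3) ℝ) (h0 : (S 0).det = 0) (h3 : (S 3).det = 0) (i j k : Fin 4) (hij : i ≠ j) (hik : i ≠ k)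
    (hjk : j ≠ k) (hmix : (((S i + S j).adjugate - (S i).adjugate - (S j).adjugate) * S k).trace = 0) :
    ((Matrix.det (∑ l, ((X : ℝ[X]) ^ d l) • (S l).map C)).roots.toFinset.filter (fun t => 0 < t)).card ≤ 16 := by
  by_contra h
  exact mixed_ne_zero_of_nullNull_seventeen d hd S h0 h3 (by omega) i j k hij hik hjk hmix

/-- **The stub's open content, in its own currency.**  `stub_nullNullCeiling` restricted to pencils with a vanishing slot coefficient HOLDS. [folklore] -/
theorem nullNullCeiling_of_slot_eq_zero (d : Fin 4 → ℕ) (S : Fin 4 → Matrix (Fin 3) (Fin 3) ℝ) (_hS : ∀ l, (S l).IsSymm)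
    (hd : StrictMono d) (h0 : (S 0).det = 0) (h3 : (S 3).det = 0)
    (hslot : (∃ l : Fin 4, l ≠ 0 ∧ l ≠ 3 ∧ (S l).det = 0) ∨ (∃ i k : Fin 4, i ≠ k ∧ ((S i).adjugate * S k).trace = 0) ∨
      (∃ i j k : Fin 4, i ≠ j ∧ i ≠ k ∧ j ≠ k ∧ (((S i + S j).adjugate - (S i).adjugate - (S j).adjugate) * S k).trace = 0)) :
    ((∑ l, (Polynomial.X : Polynomial ℝ) ^ d l • (S l).map Polynomial.C).det.roots.toFinset.filter (fun t => 0 < t)).card ≤ 16 := by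
  rcases hslot with ⟨l, hl0, hl3, hdet⟩ | ⟨i, k, hik, htr⟩ | ⟨i, j, k, hij, hik, hjk, hmix⟩
  · exact posRoots_le_16_of_nullNull_of_det_eq_zero d hd S h0 h3 l hl0 hl3 hdet
  · exact posRoots_le_16_of_nullNull_of_trace_adjugate_mul_eq_zero d hd S h0 h3 i k hik htr
  · exact posRoots_le_16_of_nullNull_of_mixed_eq_zero d hd S h0 h3 i j k hij hik hjk hmix

end Summit.ValiantsHypothesis.ValiantsHypothesis.Theorems.LacunarySymmetroidMatrixDescartes.Census
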